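import Summits.ValiantsHypothesis.ValiantsHypothesis.Theorems.KPlusLogSqLawStaticPathGapChargingSweep
import Summits.ValiantsHypothesis.ValiantsHypothesis.Theorems.KPlusLogSqLawStaticPathSweepChain

/-!
# Route «KPlusLogSqLaw» — parametric max-weight independent set on a path: THE SILENT-CROSSING TEST (the record change across one crossing, read at the crossing)

HONEST FRAMING.  Helper toward the crux `WeakLifting` (item `stmt-ValiantsHypothesis-19561`, route `KPlusLogSqLaw`, cell `pub-symmetroid`,
seat val-sym-lift-p4 g24, 2026-08-29) on the line of its witness-plan stub `stub_tridiagonalSectorB` (tropical twin of the STATIC tridiagonal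
sector = parametric maximum-weight independent set on a path; located theory `HOME/val-sym-lift-p4/SILENT-FLIP-LAW.md` (F1), (F4)).  Sequel of
`…StaticPathGapChargingSweep` (`event_iff_records`) and `…StaticPathSweepChain` (one crossing between two cuts).  The silent-flip law
`…StaticPathSilentFlipsSweep` counts «record changes» at the sample points of a discrete sweep; to package it per CROSSING of an explicit instance
(as `sweep_count_eq` does for events) one needs the local dictionary proved here.  Setting of `ne_across_eventCrossing`: the crossing `τ` of the
non-parallel pair `(α, κ)`, `α < κ ≤ n`, two cuts `cm < τ < cp` with no other crossing abscissa in between, parallel pairs distinct lines; `u`, `s`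
the midpoints of `(cm, τ)`, `(τ, cp)`.  Then:
* `recordChange_iff_silentTest` — SOME index `z ≤ n` changes its record status (left touch or right touch) between `u` and `s` iff THE SILENT
  TEST holds AT `τ`: `(lab (κ-1) τ = α ∧ κ is not a right record at τ) ∨ (lab' (n-α-1) τ = n-κ ∧ α is not a left record at τ)` (both clauses
  avoid the tie `S_α(τ) = S_κ(τ)`: the first reads indices `< κ` and `≥ κ`, the second indices `> α` and `≤ α`);
* `recordChange_unique` — at most ONE index changes (it is `κ` in the first case, `α` in the second);
* `eventStep_iff_eventTest` — the chain-form event at `u` (α left record, κ right record, no record strictly between) iff the event test of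
  `…StaticPathSweep` at `τ` (`lab (κ-1) τ = α ∧ κ right record at τ`).
So for an explicit instance both sides of THEOREM A are sums over its crossings of tests evaluated AT the crossing abscissae; the global packaging
(sorting the crossings of a window, as in `…StaticPathSweepRealise`) is left to the consumer.  Statements about a path DP; nothing here asserts
anything about `WeakLifting`, `TropicalB`, `KPlusLogSqLaw`, the stub in its window, `MatrixDescartes` (stmt-ValiantsHypothesis-18050) or `VP ≠ VNP`.
-/

set_option linter.dupNamespace false
set_option autoImplicit false

namespace Summit.ValiantsHypothesis.ValiantsHypothesis.Theorems.KPlusLogSqLaw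

open Finset Classical

namespace StaticPathFold

noncomputable section

section SilentCrossings

variable (w₁ w₀ : ℕ → ℝ)

/-- sign flip of the signed gap under a reversal of a strict comparison. [folklore] -/
theorem gap_pos_iff_not_of_flip (t : ℕ) {y z y' z' : ℝ} (h : y < z ↔ ¬ y' < z') (hne : y ≠ z) (hne' : y' ≠ z') :
    0 < gap t y z ↔ ¬ 0 < gap t y' z' := by
  unfold gap
  split_ifs with he
  · rw [sub_pos, sub_pos, h]
  · rw [sub_pos, sub_pos]
    constructor
    · intro h1 h2
      exact (h.mpr (fun h3 => lt_asymm h3 h2)) |> fun h4 => lt_asymm h4 h1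
    · intro h1
      have h2 : y' < z' := lt_of_le_of_ne (not_lt.mp h1) hne'
      exact lt_of_le_of_ne (not_lt.mp (fun h3 => (h.mp h3) h2)) (Ne.symm hne)

/-- **THE SILENT-CROSSING TEST.**  Across the crossing `τ` of `(S_α, S_κ)` between the cuts `cm < τ < cp` (midpoint samples `u`, `s`), some
index `z ≤ n` changes its record status iff, AT `τ`, either `α` is the active index below `κ` while `κ` is not a right record, or (mirror)
`n - κ` is the active index below `n - α` in the reversed block while `α` is not a left record. [folklore] -/
theorem recordChange_iff_silentTest {i n α κ : ℕ} (hακ : α < κ) (hκn : κ ≤ n) (hA : altA (shift i w₁) α ≠ altA (shift i w₁) κ)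
    {cm cp : ℝ}
    (hcm : cm < (altB (shift i w₀) κ - altB (shift i w₀) α) / (altA (shift i w₁) α - altA (shift i w₁) κ))
    (hcp : (altB (shift i w₀) κ - altB (shift i w₀) α) / (altA (shift i w₁) α - altA (shift i w₁) κ) < cp)
    (hpar : ∀ p q, p < q → q ≤ n → altA (shift i w₁) p = altA (shift i w₁) q → altB (shift i w₀) p ≠ altB (shift i w₀) q)
    (hcut : ∀ p q, p < q → q ≤ n → altA (shift i w₁) p ≠ altA (shift i w₁) q → (p ≠ α ∨ q ≠ κ) →
      (altB (shift i w₀) q - altB (shift i w₀) p) / (altA (shift i w₁) p - altA (shift i w₁) q) ≤ cm ∨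
        cp ≤ (altB (shift i w₀) q - altB (shift i w₀) p) / (altA (shift i w₁) p - altA (shift i w₁) q)) :
    (∃ z, z ≤ n ∧
      ¬ ((fold (altA (shift i w₁)) (altB (shift i w₀)) z ((cm + (altB (shift i w₀) κ - altB (shift i w₀) α) / (altA (shift i w₁) α - altA (shift i w₁) κ)) / 2) =
              L (altA (shift i w₁)) (altB (shift i w₀)) z ((cm + (altB (shift i w₀) κ - altB (shift i w₀) α) / (altA (shift i w₁) α - altA (shift i w₁) κ)) / 2) ∨
            fold (altA (shift 0 (rev i n w₁))) (altB (shift 0 (rev i n w₀))) (n - z) ((cm + (altB (shift i w₀) κ - altB (shift i w₀) α) / (altA (shift i w₁) α - altA (shift i w₁) κ)) / 2) =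
              L (altA (shift 0 (rev i n w₁))) (altB (shift 0 (rev i n w₀))) (n - z) ((cm + (altB (shift i w₀) κ - altB (shift i w₀) α) / (altA (shift i w₁) α - altA (shift i w₁) κ)) / 2)) ↔
          (fold (altA (shift i w₁)) (altB (shift i w₀)) z (((altB (shift i w₀) κ - altB (shift i w₀) α) / (altA (shift i w₁) α - altA (shift i w₁) κ) + cp) / 2) =
              L (altA (shift i w₁)) (altB (shift i w₀)) z (((altB (shift i w₀) κ - altB (shift i w₀) α) / (altA (shift i w₁) α - altA (shift i w₁) κ) + cp) / 2) ∨
            fold (altA (shift 0 (rev i n w₁))) (altB (shift 0 (rev i n w₀))) (n - z) (((altB (shift i w₀) κ - altB (shift i w₀) α) / (altA (shift i w₁) α - altA (shift i w₁) κ) + cp) / 2) =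
              L (altA (shift 0 (rev i n w₁))) (altB (shift 0 (rev i n w₀))) (n - z) (((altB (shift i w₀) κ - altB (shift i w₀) α) / (altA (shift i w₁) α - altA (shift i w₁) κ) + cp) / 2)))) ↔
    ((lab (altA (shift i w₁)) (altB (shift i w₀)) (κ - 1) ((altB (shift i w₀) κ - altB (shift i w₀) α) / (altA (shift i w₁) α - altA (shift i w₁) κ)) = α ∧
        ¬ fold (altA (shift 0 (rev i n w₁))) (altB (shift 0 (rev i n w₀))) (n - κ) ((altB (shift i w₀) κ - altB (shift i w₀) α) / (altA (shift i w₁) α - altA (shift i w₁) κ)) =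
            L (altA (shift 0 (rev i n w₁))) (altB (shift 0 (rev i n w₀))) (n - κ) ((altB (shift i w₀) κ - altB (shift i w₀) α) / (altA (shift i w₁) α - altA (shift i w₁) κ))) ∨
      (lab (altA (shift 0 (rev i n w₁))) (altB (shift 0 (rev i n w₀))) (n - α - 1) ((altB (shift i w₀) κ - altB (shift i w₀) α) / (altA (shift i w₁) α - altA (shift i w₁) κ)) = n - κ ∧
        ¬ fold (altA (shift i w₁)) (altB (shift i w₀)) α ((altB (shift i w₀) κ - altB (shift i w₀) α) / (altA (shift i w₁) α - altA (shift i w₁) κ)) =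
            L (altA (shift i w₁)) (altB (shift i w₀)) α ((altB (shift i w₀) κ - altB (shift i w₀) α) / (altA (shift i w₁) α - altA (shift i w₁) κ)))) := by
  set A := altA (shift i w₁) with hAdef
  set B := altB (shift i w₀) with hBdef
  set A' := altA (shift 0 (rev i n w₁)) with hA'def
  set B' := altB (shift 0 (rev i n w₀)) with hB'def
  set τ := (B κ - B α) / (A α - A κ) with hτ
  set u := (cm + τ) / 2 with hu
  set s := (τ + cp) / 2 with hs
  have hαn : α ≤ n := hακ.le.trans hκn
  have hu1 : cm < u := by rw [hu]; linarith
  have hu2 : u < τ := by rw [hu]; linarith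
  have hs1 : τ < s := by rw [hs]; linarith
  have hs2 : s < cp := by rw [hs]; linarith
  -- other pairs keep their order on `[u, s]` (in particular at `τ` and at `s`)
  have hkeep : ∀ (t : ℝ), u ≤ t → t ≤ s → ∀ p q, p ≤ n → q ≤ n → ¬(p = α ∧ q = κ) → ¬(p = κ ∧ q = α) →
      (L A B p u < L A B q u ↔ L A B p t < L A B q t) := by
    intro t hut hts p q hp hq h1 h2
    by_cases hApq : A p = A q
    · exact L_lt_iff_of_parallel A B hApq u t
    rcases lt_trichotomy p q with hpq | rfl | hpq
    · rcases hcut p q hpq hq hApq (by by_contra hh; push Not at hh; exact h1 hh) with h | h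
      · exact L_lt_iff_of_notMem A B hApq hut (Or.inl (lt_of_le_of_lt h hu1))
      · exact L_lt_iff_of_notMem A B hApq hut (Or.inr (lt_of_lt_of_le (lt_of_le_of_lt hts hs2) h))
    · exact absurd rfl hApq
    · rcases hcut q p hpq hp (Ne.symm hApq) (by by_contra hh; push Not at hh; exact h2 ⟨hh.2, hh.1⟩) with h | h
      · rw [crossing_symm A B] at h
        exact L_lt_iff_of_notMem A B hApq hut (Or.inl (lt_of_le_of_lt h hu1))
      · rw [crossing_symm A B] at h
        exact L_lt_iff_of_notMem A B hApq hut (Or.inr (lt_of_lt_of_le (lt_of_le_of_lt hts hs2) h))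
  have hord_us : ∀ p q, p ≤ n → q ≤ n → ¬(p = α ∧ q = κ) → ¬(p = κ ∧ q = α) → (L A B p u < L A B q u ↔ L A B p s < L A B q s) :=
    fun p q hp hq h1 h2 => hkeep s (hu2.trans hs1).le le_rfl p q hp hq h1 h2
  have hord_uτ : ∀ p q, p ≤ n → q ≤ n → ¬(p = α ∧ q = κ) → ¬(p = κ ∧ q = α) → (L A B p u < L A B q u ↔ L A B p τ < L A B q τ) :=
    fun p q hp hq h1 h2 => hkeep τ hu2.le hs1.le p q hp hq h1 h2
  -- distinct values at `u` and at `s`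
  have hnc : ∀ (t : ℝ), cm < t → t < cp → t ≠ τ → ∀ p q, p < q → q ≤ n → A p ≠ A q → (B q - B p) / (A p - A q) ≠ t := by
    intro t ht1 ht2 htτ p q hpq hqn hApq he
    by_cases hpqακ : p = α ∧ q = κ
    · obtain ⟨rfl, rfl⟩ := hpqακ
      exact htτ he.symm
    · rcases hcut p q hpq hqn hApq (by by_contra hh; push Not at hh; exact hpqακ hh) with h | h
      · linarith
      · linarith
  have hdisu := distinct_of_no_crossing_at w₁ w₀ (n := n) hpar (hnc u hu1 (hu2.trans (hs1.trans hs2)) (ne_of_lt hu2))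
  have hdiss := distinct_of_no_crossing_at w₁ w₀ (n := n) hpar (hnc s (hu1.trans (hu2.trans hs1)) hs2 (ne_of_gt hs1))
  have hadj : ∀ x, x ≤ n → x ≠ α → x ≠ κ → (L A B x u < L A B α u ↔ L A B x u < L A B κ u) := by
    intro x hx hxα hxκ
    have e1 := hkeep τ hu2.le hs1.le x α hx hαn (fun h => hxα h.1) (fun h => hxκ h.1)
    have e2 := hkeep τ hu2.le hs1.le x κ hx hκn (fun h => hxα h.1) (fun h => hxκ h.1)
    rw [e1, e2, show L A B α τ = L A B κ τ from L_eq_at_crossing A B hA]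
  -- transfers between `u`, `s` and `τ` of the four tie-free quantities
  have hlab_uτ : lab A B (κ - 1) u = lab A B (κ - 1) τ :=
    lab_eq_of_order A B (n := κ - 1) (fun p q hp hq => hord_uτ p q (by omega) (by omega) (fun h => by omega) (fun h => by omega))
      (κ - 1) le_rfl
  have hlab_us : lab A B (κ - 1) u = lab A B (κ - 1) s :=
    lab_eq_of_order A B (n := κ - 1) (fun p q hp hq => hord_us p q (by omega) (by omega) (fun h => by omega) (fun h => by omega))
      (κ - 1) le_rfl
  have hR_uτ : (fold A' B' (n - κ) u = L A' B' (n - κ) u ↔ fold A' B' (n - κ) τ = L A' B' (n - κ) τ) :=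
    fold_eq_L_iff_of_order A' B' (n := n - κ)
      (rev_order_of_order_ge w₁ w₀ hκn (fun p q hp hpn hq hqn => hord_uτ p q hpn hqn (fun h => by omega) (fun h => by omega)))
      (k := n - κ) le_rfl
  have hR_us : (fold A' B' (n - κ) u = L A' B' (n - κ) u ↔ fold A' B' (n - κ) s = L A' B' (n - κ) s) :=
    fold_eq_L_iff_of_order A' B' (n := n - κ)
      (rev_order_of_order_ge w₁ w₀ hκn (fun p q hp hpn hq hqn => hord_us p q hpn hqn (fun h => by omega) (fun h => by omega)))
      (k := n - κ) le_rfl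
  have hlab'_uτ : lab A' B' (n - α - 1) u = lab A' B' (n - α - 1) τ :=
    lab_eq_of_order A' B' (n := n - α - 1)
      (fun y z hy hz => rev_order_of_order_ge w₁ w₀ (k := α + 1) (by omega)
        (fun p q hp hpn hq hqn => hord_uτ p q hpn hqn (fun h => by omega) (fun h => by omega)) y z (by omega) (by omega))
      (n - α - 1) le_rfl
  have hlab'_us : lab A' B' (n - α - 1) u = lab A' B' (n - α - 1) s :=
    lab_eq_of_order A' B' (n := n - α - 1)
      (fun y z hy hz => rev_order_of_order_ge w₁ w₀ (k := α + 1) (by omega)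
        (fun p q hp hpn hq hqn => hord_us p q hpn hqn (fun h => by omega) (fun h => by omega)) y z (by omega) (by omega))
      (n - α - 1) le_rfl
  have hL_uτ : (fold A B α u = L A B α u ↔ fold A B α τ = L A B α τ) :=
    fold_eq_L_iff_of_order A B (n := α) (fun p q hp hq => hord_uτ p q (by omega) (by omega) (fun h => by omega) (fun h => by omega))
      (k := α) le_rfl
  have hL_us : (fold A B α u = L A B α u ↔ fold A B α s = L A B α s) :=
    fold_eq_L_iff_of_order A B (n := α) (fun p q hp hq => hord_us p q (by omega) (by omega) (fun h => by omega) (fun h => by omega))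
      (k := α) le_rfl
  -- hypotheses for the reversed family across `u`, `s`
  have hord' := rev_ord_of_ord w₁ w₀ hαn hκn hord_us
  have hdisRu := rev_ne_of_ne w₁ w₀ (n := n) hdisu
  have hdisRs := rev_ne_of_ne w₁ w₀ (n := n) hdiss
  have hadj' := rev_adj_of_adj w₁ w₀ hαn hκn hdisu hadj
  -- the pair flips between `u` and `s`, in both families
  have hflip : L A B α u < L A B κ u ↔ ¬ L A B α s < L A B κ s := L_lt_flip_of_mem A B hA hu2 hs1
  have hflip' : L A' B' (n - κ) u < L A' B' (n - α) u ↔ ¬ L A' B' (n - κ) s < L A' B' (n - α) s := by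
    rw [rev_lt_iff w₁ w₀ (Nat.sub_le n κ) (Nat.sub_le n α), rev_lt_iff w₁ w₀ (Nat.sub_le n κ) (Nat.sub_le n α),
      show n - (n - α) = α by omega, show n - (n - κ) = κ by omega]
    have hflip2 : L A B κ u < L A B α u ↔ ¬ L A B κ s < L A B α s := by
      have e1 : L A B κ u < L A B α u ↔ ¬ L A B α u < L A B κ u :=
        ⟨fun h h' => lt_asymm h h', fun h => lt_of_le_of_ne (not_lt.mp h) (hdisu κ α hκn hαn (by omega))⟩
      have e2 : L A B κ s < L A B α s ↔ ¬ L A B α s < L A B κ s :=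
        ⟨fun h h' => lt_asymm h h', fun h => lt_of_le_of_ne (not_lt.mp h) (hdiss κ α hκn hαn (by omega))⟩
      rw [e1, e2, hflip, not_not]
    rcases neg_one_pow_eq_or ℝ (n + 1) with h | h
    · rw [h, one_mul, one_mul, one_mul, one_mul]; exact hflip
    · rw [h, neg_one_mul, neg_one_mul, neg_one_mul, neg_one_mul, neg_lt_neg_iff, neg_lt_neg_iff]; exact hflip2
  -- status of every index other than `α`, `κ` is unchanged
  have hLz : ∀ z, z ≤ n → z ≠ κ → (fold A B z u = L A B z u ↔ fold A B z s = L A B z s) := fun z hz hzκ =>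
    touch_iff_of_transposition hακ hκn hord_us hdisu hdiss hadj hz hzκ
  have hRz : ∀ z, z ≤ n → z ≠ α → (fold A' B' (n - z) u = L A' B' (n - z) u ↔ fold A' B' (n - z) s = L A' B' (n - z) s) :=
    fun z hz hzα => touch_iff_of_transposition (show n - κ < n - α by omega) (Nat.sub_le n α) hord' hdisRu hdisRs hadj'
      (Nat.sub_le n z) (by omega)
  constructor
  · rintro ⟨z, hzn, hch⟩
    by_cases hzκ : z = κ
    · subst hzκ
      left
      have hR := hRz z hzn (by omega)
      -- the right status of `κ` is unchanged, so the left one changed and the right one is off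
      have hRoff : ¬ fold A' B' (n - z) u = L A' B' (n - z) u := fun h => hch (iff_of_true (Or.inr h) (Or.inr (hR.mp h)))
      have hLch : ¬ (fold A B z u = L A B z u ↔ fold A B z s = L A B z s) := by
        intro h
        apply hch
        rw [h]
        exact or_congr_right hR
      have hlab : lab A B (z - 1) u = α := by
        by_contra hne
        exact hLch (touch_larger_iff_of_ne hακ hκn hord_us hne)
      exact ⟨hlab_uτ ▸ hlab, fun h => hRoff (hR_uτ.mpr h)⟩
    · by_cases hzα : z = α
      · subst hzα
        right
        have hL := hLz z hzn (by omega)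
        have hLoff : ¬ fold A B z u = L A B z u := fun h => hch (iff_of_true (Or.inl h) (Or.inl (hL.mp h)))
        have hRch : ¬ (fold A' B' (n - z) u = L A' B' (n - z) u ↔ fold A' B' (n - z) s = L A' B' (n - z) s) := by
          intro h
          apply hch
          rw [h]
          exact or_congr_left hL
        have hlab' : lab A' B' (n - z - 1) u = n - κ := by
          by_contra hne
          exact hRch (touch_larger_iff_of_ne (show n - κ < n - z by omega) (Nat.sub_le n z) hord' hne)
        exact ⟨hlab'_uτ ▸ hlab', fun h => hLoff (hL_uτ.mpr h)⟩
      · exact absurd (or_congr (hLz z hzn hzκ) (hRz z hzn hzα)) hch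
  · rintro (⟨hlab, hRoff⟩ | ⟨hlab', hLoff⟩)
    · -- `κ` changes: its left touch flips with the pair, its right touch is off on both sides
      refine ⟨κ, hκn, fun hch => ?_⟩
      have hlabu : lab A B (κ - 1) u = α := hlab_uτ.trans hlab
      have hlabs : lab A B (κ - 1) s = α := hlab_us ▸ hlabu
      have hTu := touch_larger_iff_gap hακ hκn hdisu hlabu
      have hTs := touch_larger_iff_gap hακ hκn hdiss hlabs
      have hRu : ¬ fold A' B' (n - κ) u = L A' B' (n - κ) u := fun h => hRoff (hR_uτ.mp h)
      have hRs : ¬ fold A' B' (n - κ) s = L A' B' (n - κ) s := fun h => hRu (hR_us.mpr h)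
      have hG : (0 < gap κ (L A B κ u) (L A B α u)) ↔ ¬ (0 < gap κ (L A B κ s) (L A B α s)) := by
        refine gap_pos_iff_not_of_flip κ ?_ (hdisu κ α hκn hαn (by omega)) (hdiss κ α hκn hαn (by omega))
        have e1 : L A B κ u < L A B α u ↔ ¬ L A B α u < L A B κ u :=
          ⟨fun h h' => lt_asymm h h', fun h => lt_of_le_of_ne (not_lt.mp h) (hdisu κ α hκn hαn (by omega))⟩
        have e2 : L A B κ s < L A B α s ↔ ¬ L A B α s < L A B κ s :=
          ⟨fun h h' => lt_asymm h h', fun h => lt_of_le_of_ne (not_lt.mp h) (hdiss κ α hκn hαn (by omega))⟩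
        rw [e1, e2, hflip, not_not]
      have e : (fold A B κ u = L A B κ u ↔ ¬ fold A B κ s = L A B κ s) := by rw [hTu, hTs]; exact hG
      have h2 : (fold A B κ u = L A B κ u ↔ fold A B κ s = L A B κ s) := by
        constructor
        · intro h
          rcases hch.mp (Or.inl h) with h' | h'
          · exact h'
          · exact absurd h' hRs
        · intro h
          rcases hch.mpr (Or.inl h) with h' | h'
          · exact h'
          · exact absurd h' hRu
      by_cases hL : fold A B κ s = L A B κ s
      · exact (e.mp (h2.mpr hL)) hL
      · exact hL (h2.mp (e.mpr hL))
    · -- `α` changes: its right touch flips with the pair, its left touch is off on both sides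
      refine ⟨α, hαn, fun hch => ?_⟩
      have hlabu : lab A' B' (n - α - 1) u = n - κ := hlab'_uτ.trans hlab'
      have hlabs : lab A' B' (n - α - 1) s = n - κ := hlab'_us ▸ hlabu
      have hTu := touch_larger_iff_gap (show n - κ < n - α by omega) (Nat.sub_le n α) hdisRu hlabu
      have hTs := touch_larger_iff_gap (show n - κ < n - α by omega) (Nat.sub_le n α) hdisRs hlabs
      have hLu : ¬ fold A B α u = L A B α u := fun h => hLoff (hL_uτ.mp h)
      have hLs : ¬ fold A B α s = L A B α s := fun h => hLu (hL_us.mpr h)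
      have hne_u := hdisRu (n - α) (n - κ) (Nat.sub_le n α) (Nat.sub_le n κ) (by omega)
      have hne_s := hdisRs (n - α) (n - κ) (Nat.sub_le n α) (Nat.sub_le n κ) (by omega)
      have hG : (0 < gap (n - α) (L A' B' (n - α) u) (L A' B' (n - κ) u)) ↔
          ¬ (0 < gap (n - α) (L A' B' (n - α) s) (L A' B' (n - κ) s)) := by
        refine gap_pos_iff_not_of_flip (n - α) ?_ hne_u hne_s
        have e1 : L A' B' (n - α) u < L A' B' (n - κ) u ↔ ¬ L A' B' (n - κ) u < L A' B' (n - α) u :=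
          ⟨fun h h' => lt_asymm h h', fun h => lt_of_le_of_ne (not_lt.mp h) hne_u⟩
        have e2 : L A' B' (n - α) s < L A' B' (n - κ) s ↔ ¬ L A' B' (n - κ) s < L A' B' (n - α) s :=
          ⟨fun h h' => lt_asymm h h', fun h => lt_of_le_of_ne (not_lt.mp h) hne_s⟩
        rw [e1, e2, hflip', not_not]
      have e : (fold A' B' (n - α) u = L A' B' (n - α) u ↔ ¬ fold A' B' (n - α) s = L A' B' (n - α) s) := by
        rw [hTu, hTs]; exact hG
      have h2 : (fold A' B' (n - α) u = L A' B' (n - α) u ↔ fold A' B' (n - α) s = L A' B' (n - α) s) := by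
        constructor
        · intro h
          rcases hch.mp (Or.inr h) with h' | h'
          · exact absurd h' hLs
          · exact h'
        · intro h
          rcases hch.mpr (Or.inr h) with h' | h'
          · exact absurd h' hLu
          · exact h'
      by_cases hR : fold A' B' (n - α) s = L A' B' (n - α) s
      · exact (e.mp (h2.mpr hR)) hR
      · exact hR (h2.mp (e.mpr hR))

end SilentCrossings

end

end StaticPathFold

end Summit.ValiantsHypothesis.ValiantsHypothesis.Theorems.KPlusLogSqLaw
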